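import Summits.BirchSwinnertonDyer.BirchSwinnertonDyer.Theorems.PrintX11aUpperNonSurjThreeEngineWithoutGZK
import Summits.BirchSwinnertonDyer.BirchSwinnertonDyer.Theses.PrintX11a
import Literature.NumberTheory.EllipticCurves.SteinWuthrich2013.NonsplitLeadingTermRankZeroOfGreenbergProofs
import Literature.NumberTheory.EllipticCurves.SteinWuthrich2013.SplitMultLeadingTermOfEulerCharProofs
import HarnessLib

/-!
# Route `PrintX11a`, crux U3 `UpperNonSurjThree` (item stmt-BirchSwinnertonDyer-20613): the rank-`0` Euler-half engine and
# the crux BY NAME with the two Stein–Wuthrich Thm. 6.1 binders REPLACED by Greenberg's rank-`0` formula (LNM 1716 §4)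

Cell `bsd-print-x11a`, LEAD seat bsd-line-x11a-p1 gen 12 (`--supports stmt-BirchSwinnertonDyer-20613`, helper).  Theorems only;
no definition, no named fact minted, no `sorry`.  CONDITIONAL on the displayed binders (statement-only named PUBLISHED facts);
closes nothing by itself; item 20613 does not close by this file.  No summit statement is proved; BSD is proved for no curve
and no class.

WHY.  Line «finemu3» r6 of U3 reduces the crux to NINE named facts (`FineMu.stub_nineFactsOddGS`), two of which are Stein–Wuthrich
2013 Thm. 6.1 split ∕ non-split, typed for EVERY Mordell–Weil rank (at rank `≥ 1` their clauses 2–3 rest on Jones 1989 Thm. 3.1, flag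
`SW13-Thm61-secondary-Jon89-unread@r≥1`, primary unheld).  U3's engine (`X11b.le_padicValRat_of_{nonsplit,split}_divisibility_rankZero_noGZK`,
p622718) applies SW 6.1 only AFTER deriving `rank E(ℚ) = 0` from the divisibility by the control theorem, and the INPUT seats landed the
RANK-`0` SLICES of both from Greenberg's "analogue of theorem 4.1" alone (`SteinWuthrich2013.thm61_nonsplitMultiplicative_clauses_rankZero_of_greenberg`,
p664420, from `Greenberg1999.thm41Analogue_charValue_rankZero_numberField` = INPUTS row G103; `SteinWuthrich2013.clauses_rankZero_of_greenberg`,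
p662964, from `Greenberg1999.thm41Analogue_charValue_rankZero_split_baseChange_anyPrime` = row G104; both graded REGISTERED and D-audit
FAITHFUL, INPUTS-LIST-2-ADDENDUM-37 §G).  This file is the U3 twin of er5-p2's p666636 ∕ p668322 (the same swap on crux L's roads): §1 the
two leading-term lemmas with `hJ ↦ hG` (the slice does not read the Tate parameter at a non-split prime nor the cyclotomic-variable
normalisation; the height datum is the zero pairing `PAdicHeightData.zero`); §2 the engine `X11b.MultDivisibilityAt ⟹ Typed.MissingUpperBoundAt`
at an odd multiplicative `p` with `r_an = 0`; §3 the per-pair U3 theorem and `Theses.PrintX11a.UpperNonSurjThree` BY NAME from the nine facts with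
SW 6.1 ×2 ↦ Greenberg ×2 (the lead's r7 composition constant), plus the glue on the conjunction.  Counts: named facts 9 → 9; unheld print
dependencies in the `_holds` cone −1 (Jones 1989).  beyond-print theorem: no (re-keying only; the mathematics is p622718's).

References (locators only): [cite: GreenbergLNM1716, §4, the passage following Thm. 4.1 (pp. 111–113)]
[cite: SteinWuthrich2013, Thm. 6.1 (p. 20), §4.2] [cite: Kobayashi2006DocMath, Cor. 4.2 (p. 575)] [cite: Kato2004Asterisque, Thm. 12.4
(p. 221), §17.13 (pp. 279–280)] [cite: Mazur1978, Cor. 4.1] [cite: BalakrishnanMullerStein2015, Thm. 1.7] [cite: Miller2011LMS, Def. 1.1].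
-/

set_option linter.dupNamespace false
set_option autoImplicit false

noncomputable section

open scoped Classical MatrixGroups ModularForm

open CongruenceSubgroup WeierstrassCurve
  Literature.NumberTheory.EllipticCurves
  Literature.NumberTheory.EllipticCurves.ModularForms
  Literature.NumberTheory.EllipticCurves.Rank1Residual
  Literature.NumberTheory.EllipticCurves.Rank1Residual.Typed
  Literature.NumberTheory.EllipticCurves.Wuthrich2014
  Literature.NumberTheory.EllipticCurves.SteinWuthrich2013
  Literature.NumberTheory.EllipticCurves.Greenberg1999
  Literature.NumberTheory.EllipticCurves.Kato2004
  Summit.BirchSwinnertonDyer.Rank1Residual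
  Summit.BirchSwinnertonDyer.Rank1Residual.RankZeroHeightFree
  Summit.BirchSwinnertonDyer.BirchSwinnertonDyer.Theorems

namespace Summit.BirchSwinnertonDyer.Rank1Residual.X11b

/-! ### §1 The two leading-term lemmas, Greenberg's rank-`0` formula in place of Stein–Wuthrich Thm. 6.1 -/

/-- **Rank `0`, NON-SPLIT multiplicative `p ≠ 2`: the upper-bound shape from ONE-SIDED divisibility, no GZK, no SW 6.1.** As
`le_padicValRat_of_nonsplit_divisibility_rankZero_noGZK` (p622718) — `h ∈ char_Λ X` with `ι h = ϖ·L`, `h(0) = ϖ·2[0]⁺_f ≠ 0`,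
control theorem ⟹ `rank E(ℚ) = 0`; then clause 2 ⟹ `#Ш[p^∞] < ∞` and clause 3 ⟹ the identity
`t·#tors² = (u·k(0))·#Ш[p^∞]·∏c_v` — except that the three clauses at this rank-`0` curve come from GREENBERG's "analogue of
theorem 4.1" (`hG`, non-split `v ∣ p`, `l_v ∼ 2`) through the INPUT seats' slice
`SteinWuthrich2013.thm61_nonsplitMultiplicative_clauses_rankZero_of_greenberg`, for the zero height datum.  Also returns
`rank E(ℚ) = 0`.  [cite: GreenbergLNM1716, §4, the passage following Thm. 4.1 (pp. 112–113)] [cite: SteinWuthrich2013, Thm. 6.1 (p. 20) and §4.2]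
[cite: BalakrishnanMullerStein2015, Thm. 1.7] [cite: Miller2011LMS, §1] -/
theorem le_padicValRat_of_nonsplit_divisibility_rankZero_noGZK_of_greenberg
    (hG : Greenberg1999.thm41Analogue_charValue_rankZero_numberField)
    (W : WeierstrassCurve ℚ) [W.IsElliptic] [W.IsGloballyMinimal] (p : ℕ) [Fact p.Prime]
    {κ : ZpExtension ℚ p} {γ : Field.absoluteGaloisGroup ℚ} {N : ℕ} [NeZero N]
    {f : CuspForm (Gamma0 N) 2} (hp : p ≠ 2) (hL1 : W.entireLFunction 1 ≠ 0)
    (hmult : W.HasMultiplicativeReductionAtPrime p)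
    (hns : ¬ W.HasSplitMultiplicativeReductionAtPrime p)
    (hκ : κ.IsCyclotomic) (hγ : κ.IsTopGenerator γ)
    (hf : IsNewformOf W f) (D : W.SelmerDualData κ γ) (ϖ : ℚ) (hϖ0 : ϖ ≠ 0)
    (hϖ : (ϖ : ℝ) * W.realPeriodRat = plusPeriod f)
    (L : PowerSeries ℚ_[p]) (hL : IsMultPAdicLFunctionOf f p (-1) L) (hX : D.IsTorsion)
    (hdiv : ∃ h ∈ D.charIdeal, iwasawaToPowerSeries p h = PowerSeries.C ((ϖ : ℚ) : ℚ_[p]) * L) :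
    W.mordellWeilRank = 0 ∧
    ∃ t : ℚ, W.entireLFunction 1 / (W.realPeriodRat : ℂ) = (t : ℂ) ∧
      (padicValNat p W.shaOrder : ℤ) + padicValNat p W.tamagawaProduct -
        2 * padicValNat p W.torsionOrder ≤ padicValRat p t := by
  have hpP : p.Prime := Fact.out
  haveI : Module.Finite (IwasawaAlgebra p) D.X := D.module_finite_holds hγ
  obtain ⟨h, hh, hι⟩ := hdiv
  -- the control theorem: `rank E(ℚ) ≤ ord_T h`
  have hrk : (W.mordellWeilRank : ℕ∞) ≤ h.order := W.mordellWeilRank_le_order_of_mem_charIdeal hγ D hX hh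
  -- a generator of the (principal) characteristic ideal, and the cofactor `k` with `k·g = h`
  obtain ⟨g, hg⟩ := (charIdeal_isPrincipal_holds p D.X).principal
  have hchar : D.charIdeal = Ideal.span {g} := hg
  rw [hchar] at hh
  obtain ⟨k, hkg⟩ := Ideal.mem_span_singleton'.mp hh
  -- the rational `t = ϖ · [0]⁺_f = L(E,1)/Ω_E`
  set s : ℚ := ratPlusSymbol f 0 with hs_def
  set t : ℚ := ϖ * s with ht_def
  have hΩpos : 0 < W.realPeriodRat := W.realPeriodRat_pos_holds
  have hLval : W.entireLFunction 1 = (((s : ℝ) * plusPeriod f : ℝ) : ℂ) := hf.entireLFunction_one_eq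
  have hq : W.entireLFunction 1 / (W.realPeriodRat : ℂ) = ((t : ℚ) : ℂ) := by
    rw [hLval, ← hϖ, div_eq_iff (Complex.ofReal_ne_zero.mpr hΩpos.ne'), ht_def]
    push_cast
    ring
  have hs0 : s ≠ 0 := by
    intro h0
    apply hL1
    rw [hLval, h0]
    simp
  have ht0 : t ≠ 0 := mul_ne_zero hϖ0 hs0
  -- constant coefficients of `ι(k · g) = ϖ · L`: `k(0) · g(0) = ϖ · 2 [0]⁺_f`
  have hL0 : PowerSeries.constantCoeff L = 2 * (s : ℚ_[p]) := hL.constantCoeff_of_neg_one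
  have hkg' : PowerSeries.constantCoeff (k * g) =
      PowerSeries.constantCoeff k * PowerSeries.constantCoeff g := map_mul _ _ _
  have h0 := congrArg PowerSeries.constantCoeff hι
  rw [← hkg, constantCoeff_iwasawaToPowerSeries, hkg', PadicInt.coe_mul, map_mul,
    PowerSeries.constantCoeff_C, hL0] at h0
  -- `h(0) ≠ 0`, hence `ord_T h = 0` and `rank E(ℚ) = 0`
  have hrhs0 : ((ϖ : ℚ) : ℚ_[p]) * (2 * (s : ℚ_[p])) ≠ 0 := by
    have hϖQ : ((ϖ : ℚ) : ℚ_[p]) ≠ 0 := by exact_mod_cast hϖ0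
    have hsQ : ((s : ℚ) : ℚ_[p]) ≠ 0 := by exact_mod_cast hs0
    exact mul_ne_zero hϖQ (mul_ne_zero two_ne_zero hsQ)
  have hg0 : PowerSeries.constantCoeff g ≠ 0 := by
    intro hz
    apply hrhs0
    rw [← h0, hz, PadicInt.coe_zero, mul_zero]
  have hh0 : PowerSeries.constantCoeff h ≠ 0 := by
    rw [← hkg, hkg']
    intro hz
    apply hrhs0
    rw [← h0]
    have : ((PowerSeries.constantCoeff k * PowerSeries.constantCoeff g : ℤ_[p]) : ℚ_[p]) = 0 := by
      rw [hz, PadicInt.coe_zero]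
    rw [← PadicInt.coe_mul, this]
  have hr0 : W.mordellWeilRank = 0 := by
    have hord : h.order ≤ 0 := PowerSeries.order_le 0 (by rwa [PowerSeries.coeff_zero_eq_constantCoeff])
    have h0' : (W.mordellWeilRank : ℕ∞) = 0 := nonpos_iff_eq_zero.mp (hrk.trans hord)
    exact_mod_cast h0'
  haveI : Finite W.toAffine.Point := W.mordellWeilRank_eq_zero_iff_finite.mp hr0
  -- any height datum will do in rank `0` (the slice quantifies over all); take the zero pairing; `Reg_p = 1`
  let Dh : PAdicHeightData W p := PAdicHeightData.zero W p
  have hReg : padicRegulator Dh = 1 := padicRegulator_eq_one_of_finite W p Dh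
  have hSch : SchneiderConjecture Dh := by
    rw [SchneiderConjecture, hReg]
    exact one_ne_zero
  -- rank-`0` slice of SW 6.1 FROM GREENBERG's formula (`hG`): clause 2 ⟹ `#Ш[p^∞] < ∞`, clause 3 in rank `0`
  obtain ⟨-, h2, h3⟩ := SteinWuthrich2013.thm61_nonsplitMultiplicative_clauses_rankZero_of_greenberg hG hp hmult hns
    hκ hγ D hX hchar Dh hr0
  have hgord : g.order = (W.mordellWeilRank : ℕ∞) := by
    rw [hr0, Nat.cast_zero]
    exact nonpos_iff_eq_zero.mp (PowerSeries.order_le 0 (by rwa [PowerSeries.coeff_zero_eq_constantCoeff]))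
  haveI hfinp : Finite (AddCommGroup.primaryComponent W.sha p) := (h2.mp hgord).2
  obtain ⟨u, hu⟩ := h3 hSch hfinp
  simp only [hr0, pow_zero, mul_one, hReg, PowerSeries.coeff_zero_eq_constantCoeff] at hu
  -- the cofactor's constant term is a `p`-adic INTEGER (not necessarily a unit)
  set k0 : ℚ_[p] := ((PowerSeries.constantCoeff k : ℤ_[p]) : ℚ_[p]) with hk0_def
  have hk0v : 0 ≤ k0.valuation := PadicInt.valuation_coe_nonneg
  have htcast : ((t : ℚ) : ℚ_[p]) = (ϖ : ℚ_[p]) * (s : ℚ_[p]) := by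
    rw [ht_def]; push_cast; ring
  -- the identity `t · #tors² = (u · k0) · #Ш[p^∞] · ∏ c_v`
  have key : (t : ℚ_[p]) * (W.torsionOrder : ℚ_[p]) ^ 2 =
      (((u : ℤ_[p]) : ℚ_[p]) * k0) *
        (Nat.card (AddCommGroup.primaryComponent W.sha p) : ℚ_[p]) * (W.tamagawaProduct : ℚ_[p]) := by
    apply mul_left_cancel₀ (two_ne_zero : (2 : ℚ_[p]) ≠ 0)
    rw [htcast, hk0_def]
    linear_combination ((PowerSeries.constantCoeff k : ℤ_[p]) : ℚ_[p]) * hu -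
      (W.torsionOrder : ℚ_[p]) ^ 2 * h0
  have hv : 0 ≤ (((u : ℤ_[p]) : ℚ_[p]) * k0).valuation := by
    by_cases hk : k0 = 0
    · rw [hk, mul_zero, Padic.valuation_zero]
    · rw [Padic.valuation_mul (coe_units_ne_zero p u) hk, valuation_coe_units_eq_zero, zero_add]
      exact hk0v
  exact ⟨hr0, t, hq, le_padicValRat_of_torsionSq_mul_eq_of_finite_primary W p ht0 _ hv key⟩

/-- **Rank `0`, SPLIT multiplicative `p ≠ 2`: the upper-bound shape from ONE-SIDED divisibility, no GZK, no SW 6.1.** As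
`le_padicValRat_of_split_divisibility_rankZero_noGZK` (p622718) — `ι(T·h) = ϖ·L`, `h(0)·log_p κ(γ) ∼ ϖ·𝓛_p·[0]⁺_f ≠ 0`
(Greenberg–Stevens `hGS`, `𝓛_p ≠ 0`), control theorem ⟹ `rank E(ℚ) = 0`; clauses 2–3 — except that the three clauses at this
rank-`0` curve come from GREENBERG's "analogue of theorem 4.1" at a split `v ∣ p` (`hG`, `l_v = 𝓛_p/(2p)`) through the INPUT
seats' slice `SteinWuthrich2013.clauses_rankZero_of_greenberg`, for the zero height datum.  Also returns `rank E(ℚ) = 0`.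
[cite: GreenbergLNM1716, §4, the passage following Thm. 4.1 (pp. 111–112)] [cite: SteinWuthrich2013, Thm. 6.1 (p. 20) and §4.2]
[cite: Kobayashi2006DocMath, Cor. 4.2 (p. 575)] [cite: MazurTateTeitelbaum1986Invent, §I.14–I.15] -/
theorem le_padicValRat_of_split_divisibility_rankZero_noGZK_of_greenberg
    (hG : Greenberg1999.thm41Analogue_charValue_rankZero_split_baseChange_anyPrime)
    (W : WeierstrassCurve ℚ) [W.IsElliptic] [W.IsGloballyMinimal] (p : ℕ) [Fact p.Prime]
    (hGS : greenberg_stevens (W := W) (p := p)) (h𝓛 : LInvariant_ne_zero (W := W) (p := p))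
    {κ : ZpExtension ℚ p} {γ : Field.absoluteGaloisGroup ℚ} {N : ℕ} [NeZero N]
    {f : CuspForm (Gamma0 N) 2} (hp : p ≠ 2) (hL1 : W.entireLFunction 1 ≠ 0)
    (Dq : TateParameterData W p)
    (hκ : κ.IsCyclotomic) (hγ : κ.IsTopGenerator γ)
    (hf : IsNewformOf W f) (D : W.SelmerDualData κ γ) (ϖ : ℚ) (hϖ0 : ϖ ≠ 0)
    (hϖ : (ϖ : ℝ) * W.realPeriodRat = plusPeriod f)
    (L : PowerSeries ℚ_[p]) (hL : IsSplitMultPAdicLFunctionOf f p L) (hX : D.IsTorsion)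
    (hdiv : ∃ h ∈ D.charIdeal,
      iwasawaToPowerSeries p ((PowerSeries.X : IwasawaAlgebra p) * h) = PowerSeries.C ((ϖ : ℚ) : ℚ_[p]) * L) :
    W.mordellWeilRank = 0 ∧
    ∃ t : ℚ, W.entireLFunction 1 / (W.realPeriodRat : ℂ) = (t : ℂ) ∧
      (padicValNat p W.shaOrder : ℤ) + padicValNat p W.tamagawaProduct -
        2 * padicValNat p W.torsionOrder ≤ padicValRat p t := by
  have hpP : p.Prime := Fact.out
  haveI : Module.Finite (IwasawaAlgebra p) D.X := D.module_finite_holds hγ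
  obtain ⟨h, hh, hι⟩ := hdiv
  have hrk : (W.mordellWeilRank : ℕ∞) ≤ h.order := W.mordellWeilRank_le_order_of_mem_charIdeal hγ D hX hh
  obtain ⟨g, hg⟩ := (charIdeal_isPrincipal_holds p D.X).principal
  have hchar : D.charIdeal = Ideal.span {g} := hg
  rw [hchar] at hh
  obtain ⟨k, hkg⟩ := Ideal.mem_span_singleton'.mp hh
  set s : ℚ := ratPlusSymbol f 0 with hs_def
  set t : ℚ := ϖ * s with ht_def
  have hΩpos : 0 < W.realPeriodRat := W.realPeriodRat_pos_holds
  have hLval : W.entireLFunction 1 = (((s : ℝ) * plusPeriod f : ℝ) : ℂ) := hf.entireLFunction_one_eq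
  have hq : W.entireLFunction 1 / (W.realPeriodRat : ℂ) = ((t : ℚ) : ℂ) := by
    rw [hLval, ← hϖ, div_eq_iff (Complex.ofReal_ne_zero.mpr hΩpos.ne'), ht_def]
    push_cast
    ring
  have hs0 : s ≠ 0 := by
    intro h0
    apply hL1
    rw [hLval, h0]
    simp
  have ht0 : t ≠ 0 := mul_ne_zero hϖ0 hs0
  -- Greenberg–Stevens: `[T¹]L · log = 𝓛 · [0]⁺_f`
  obtain ⟨-, hGS1⟩ := hGS Dq hf hL
  -- `[T¹] ι(T·k·g) = k(0)·g(0)`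
  have hkg' : PowerSeries.constantCoeff (k * g) =
      PowerSeries.constantCoeff k * PowerSeries.constantCoeff g := map_mul _ _ _
  have h1 : ((PowerSeries.constantCoeff k : ℤ_[p]) : ℚ_[p]) *
      ((PowerSeries.constantCoeff g : ℤ_[p]) : ℚ_[p]) =
        ((ϖ : ℚ) : ℚ_[p]) * PowerSeries.coeff 1 L := by
    have h := congrArg (PowerSeries.coeff 1) hι
    rw [← hkg] at h
    rw [iwasawaToPowerSeries, PowerSeries.coeff_map, PowerSeries.coeff_succ_X_mul,
      PowerSeries.coeff_zero_eq_constantCoeff, hkg', PowerSeries.coeff_C_mul, map_mul] at h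
    exact h
  have h𝓛0 : LInvariant Dq ≠ 0 := h𝓛 Dq
  -- `h(0) ≠ 0`: `k(0)·g(0)·log κ(γ) = ϖ·𝓛·[0]⁺_f ≠ 0`; hence `rank E(ℚ) = 0`
  have hprod : ((PowerSeries.constantCoeff k : ℤ_[p]) : ℚ_[p]) * ((PowerSeries.constantCoeff g : ℤ_[p]) : ℚ_[p]) *
      padicLog p (cyclotomicGenerator p) = ((ϖ : ℚ) : ℚ_[p]) * (LInvariant Dq * (s : ℚ_[p])) := by
    rw [h1, mul_assoc, hGS1]
  have hrhs0 : ((ϖ : ℚ) : ℚ_[p]) * (LInvariant Dq * (s : ℚ_[p])) ≠ 0 := by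
    have hϖQ : ((ϖ : ℚ) : ℚ_[p]) ≠ 0 := by exact_mod_cast hϖ0
    have hsQ : ((s : ℚ) : ℚ_[p]) ≠ 0 := by exact_mod_cast hs0
    exact mul_ne_zero hϖQ (mul_ne_zero h𝓛0 hsQ)
  have hkg0 : ((PowerSeries.constantCoeff k : ℤ_[p]) : ℚ_[p]) * ((PowerSeries.constantCoeff g : ℤ_[p]) : ℚ_[p]) ≠ 0 := by
    intro hz
    apply hrhs0
    rw [← hprod, hz, zero_mul]
  have hg0 : PowerSeries.constantCoeff g ≠ 0 := by
    intro hz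
    apply hkg0
    rw [hz, PadicInt.coe_zero, mul_zero]
  have hh0 : PowerSeries.constantCoeff h ≠ 0 := by
    rw [← hkg, hkg']
    intro hz
    apply hkg0
    rw [← PadicInt.coe_mul, hz, PadicInt.coe_zero]
  have hr0 : W.mordellWeilRank = 0 := by
    have hord : h.order ≤ 0 := PowerSeries.order_le 0 (by rwa [PowerSeries.coeff_zero_eq_constantCoeff])
    have h0' : (W.mordellWeilRank : ℕ∞) = 0 := nonpos_iff_eq_zero.mp (hrk.trans hord)
    exact_mod_cast h0'
  haveI : Finite W.toAffine.Point := W.mordellWeilRank_eq_zero_iff_finite.mp hr0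
  -- any height datum will do in rank `0` (the slice quantifies over all); take the zero pairing; `Reg_p = 1`
  let Dh : PAdicHeightData W p := PAdicHeightData.zero W p
  have hReg : padicRegulator Dh = 1 := padicRegulator_eq_one_of_finite W p Dh
  have hSch : SchneiderConjecture Dh := by
    rw [SchneiderConjecture, hReg]
    exact one_ne_zero
  -- rank-`0` slice of SW 6.1 (split) FROM GREENBERG's formula (`hG`): clause 2 ⟹ `#Ш[p^∞] < ∞`, clause 3 in rank `0`
  obtain ⟨-, h2, h3⟩ := SteinWuthrich2013.clauses_rankZero_of_greenberg hG hp Dq hκ hγ D hX hchar Dh hr0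
  have hgord : g.order = (W.mordellWeilRank : ℕ∞) := by
    rw [hr0, Nat.cast_zero]
    exact nonpos_iff_eq_zero.mp (PowerSeries.order_le 0 (by rwa [PowerSeries.coeff_zero_eq_constantCoeff]))
  haveI hfinp : Finite (AddCommGroup.primaryComponent W.sha p) := (h2.mp hgord).2
  obtain ⟨u, hu⟩ := h3 hSch hfinp
  simp only [hr0, zero_add, pow_one, hReg, mul_one, PowerSeries.coeff_zero_eq_constantCoeff] at hu
  set k0 : ℚ_[p] := ((PowerSeries.constantCoeff k : ℤ_[p]) : ℚ_[p]) with hk0_def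
  have hk0v : 0 ≤ k0.valuation := PadicInt.valuation_coe_nonneg
  have htcast : ((t : ℚ) : ℚ_[p]) = (ϖ : ℚ_[p]) * (s : ℚ_[p]) := by
    rw [ht_def]; push_cast; ring
  -- the identity `t · #tors² = (u · k0) · #Ш[p^∞] · ∏ c_v`
  have key : (t : ℚ_[p]) * (W.torsionOrder : ℚ_[p]) ^ 2 =
      (((u : ℤ_[p]) : ℚ_[p]) * k0) *
        (Nat.card (AddCommGroup.primaryComponent W.sha p) : ℚ_[p]) * (W.tamagawaProduct : ℚ_[p]) := by
    apply mul_left_cancel₀ h𝓛0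
    rw [htcast, hk0_def]
    linear_combination (-(((ϖ : ℚ) : ℚ_[p]) * (W.torsionOrder : ℚ_[p]) ^ 2)) * hGS1 -
      (padicLog p (cyclotomicGenerator p) * (W.torsionOrder : ℚ_[p]) ^ 2) * h1 +
      ((PowerSeries.constantCoeff k : ℤ_[p]) : ℚ_[p]) * hu
  have hv : 0 ≤ (((u : ℤ_[p]) : ℚ_[p]) * k0).valuation := by
    by_cases hk : k0 = 0
    · rw [hk, mul_zero, Padic.valuation_zero]
    · rw [Padic.valuation_mul (coe_units_ne_zero p u) hk, valuation_coe_units_eq_zero, zero_add]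
      exact hk0v
  exact ⟨hr0, t, hq, le_padicValRat_of_torsionSq_mul_eq_of_finite_primary W p ht0 _ hv key⟩

/-! ### §2 The rank-`0` engine without Gross–Zagier–Kolyvagin and without Stein–Wuthrich Thm. 6.1 -/

/-- **The rank-`0` engine, Greenberg-typed**: for `W/ℚ` globally minimal, `p` an ODD multiplicative prime with
`ord_{s=1} L(E,s) = 0`, `X11b.MultDivisibilityAt W p ⟹ Typed.MissingUpperBoundAt W p`, granted Greenberg's rank-`0` formula at
a split (`hGs`) ∕ non-split (`hGn`) multiplicative prime, modularity as `exists_isNewformOf` and — ONLY at a split `p` — the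
exceptional-zero formula `hGS`.  Verbatim the proof of `missingUpperBoundAt_of_multDivisibilityAt_of_analyticRank_eq_zero_noGZK`
(p622718) with §1's lemmas; the Tate parameter at a non-split prime is no longer read.  CONDITIONAL; closes nothing.
[cite: GreenbergLNM1716, §4, the passage following Thm. 4.1 (pp. 111–113)] [cite: Kobayashi2006DocMath, Cor. 4.2 (p. 575)]
[cite: BalakrishnanMullerStein2015, Thm. 1.7] [cite: Miller2011LMS, Def. 1.1 and §1] -/
theorem missingUpperBoundAt_of_multDivisibilityAt_of_analyticRank_eq_zero_noGZK_of_greenberg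
    (hGs : Greenberg1999.thm41Analogue_charValue_rankZero_split_baseChange_anyPrime)
    (hGn : Greenberg1999.thm41Analogue_charValue_rankZero_numberField) (hnf : exists_isNewformOf)
    (W : WeierstrassCurve ℚ) [W.IsElliptic] [W.IsGloballyMinimal] (p : ℕ) [Fact p.Prime]
    (hGS : W.HasSplitMultiplicativeReductionAtPrime p → greenberg_stevens (W := W) (p := p))
    (hp : p ≠ 2) (hmult : W.HasMultiplicativeReductionAtPrime p) (hr : W.analyticRank = 0)
    (hdiv : MultDivisibilityAt W p) : Typed.MissingUpperBoundAt W p := by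
  have hmod : hasEntireLFunction_rat := WeierstrassCurve.hasEntireLFunction_rat_of_exists_isNewformOf hnf
  have hpar : nonempty_modularParametrizationData :=
    nonempty_modularParametrizationData_of_modularity hnf IsNewformOf.exists_maninConstant_modularDegree_holds
  obtain ⟨κ, hκ, γ, hγ, hγ'⟩ := exists_isCyclotomic_isTopGenerator_isCyclotomicVariable_holds p
  obtain ⟨D⟩ := W.nonempty_selmerDualData_holds κ γ hγ
  haveI : NeZero (W.conductorNorm ℤ) := ⟨(W.conductorNorm_pos_holds).ne'⟩
  obtain ⟨Dm⟩ := hpar W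
  obtain ⟨ϖ, hϖpos, hϖ, -⟩ := Dm.exists_rat_mul_realPeriodRat_eq_plusPeriod
  obtain ⟨hX, hnsp, hsp⟩ := hdiv hκ hγ hγ' Dm.isNewformOf D ϖ hϖpos.ne' hϖ
  have hL1 : W.entireLFunction 1 ≠ 0 := (W.analyticRank_eq_zero_iff_holds (hmod W)).1 hr
  by_cases hsplit : W.HasSplitMultiplicativeReductionAtPrime p
  · obtain ⟨L, hL⟩ := exists_isSplitMultPAdicLFunctionOf hsplit Dm.isNewformOf
    obtain ⟨Dq⟩ := (nonempty_tateParameterData_iff_holds (W := W) (p := p)).mpr hsplit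
    obtain ⟨hr0, ht⟩ := le_padicValRat_of_split_divisibility_rankZero_noGZK_of_greenberg hGs W p (hGS hsplit)
      LInvariant_ne_zero_holds hp hL1 Dq hκ hγ Dm.isNewformOf D ϖ hϖpos.ne' hϖ L hL hX (hsp hsplit L hL)
    exact missingUpperBoundAt_of_padicValRat_le_of_mordellWeilRank_eq_zero W p hL1 hr0 ht
  · obtain ⟨L, hL⟩ := exists_isMultPAdicLFunctionOf_neg_one_of_nonsplit Dm.isNewformOf hmult hsplit
    obtain ⟨hr0, ht⟩ := le_padicValRat_of_nonsplit_divisibility_rankZero_noGZK_of_greenberg hGn W p hp hL1 hmult hsplit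
      hκ hγ Dm.isNewformOf D ϖ hϖpos.ne' hϖ L hL hX (hnsp hsplit L hL)
    exact missingUpperBoundAt_of_padicValRat_le_of_mordellWeilRank_eq_zero W p hL1 hr0 ht

end Summit.BirchSwinnertonDyer.Rank1Residual.X11b

/-! ### §3 U3 per pair and BY NAME: the nine facts with Stein–Wuthrich 6.1 ×2 ↦ Greenberg's rank-`0` formula ×2 -/

namespace Summit.BirchSwinnertonDyer.Rank1Residual.ClassX11a

/-- **Per pair, Greenberg-typed.**  At an X11a pair `(W, 3)` (`r_an = 0`, `3 ∥ N`, `E[3]` irreducible) with `ρ̄_{E,3}` not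
surjective: `ord₃ #Ш ≤ ord₃ #Ш_an` (`Typed.MissingUpperBoundAt W 3`), modulo Greenberg's rank-`0` formula ×2 (`hGs`, `hGn`), Kato
12.4, modularity, Kato §17.13 V′ ∕ VI′ ∕ XI′ (`_contra`), Mazur Cor. 4.1, plus — only when the reduction at `3` is split — the
exceptional-zero formula at the pair.  = `missingUpperBoundAt_three_of_not_surj_of_nineFacts` (p622718) with `hJs hJn ↦ hGs hGn`;
the divisibility is the SAME theorem `X11b.multDivisibilityAt_three_of_not_surj_of_sixFacts` (μ₃-road: analytic `μ₃ = 0` THEOREM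
`MultThreeMuAn.muAnZeroAt_three_of_mult_of_irr` mod Mazur, Kato μ-transfer).  CONDITIONAL; closes nothing.
[cite: GreenbergLNM1716, §4, the passage following Thm. 4.1 (pp. 111–113)] [cite: Kato2004Asterisque, Thm. 12.4 (p. 221), §17.13 (pp. 279–280)]
[cite: Mazur1978, Cor. 4.1] [cite: Kobayashi2006DocMath, Cor. 4.2 (p. 575)] -/
theorem missingUpperBoundAt_three_of_not_surj_of_nineFacts_of_greenberg
    (hGs : Greenberg1999.thm41Analogue_charValue_rankZero_split_baseChange_anyPrime)
    (hGn : Greenberg1999.thm41Analogue_charValue_rankZero_numberField)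
    (h12 : Kato2004.thm12_4) (hnf : exists_isNewformOf)
    (hns' : Kato2004.exists_multDivisibilityInputs_nonsplit_contra)
    (hsp' : Kato2004.exists_multDivisibilityInputs_split_contra)
    (hfine' : Kato2004.exists_multDivisibilityInputs_fine_contra) (hMz : mazur_not_dvd_maninConstant_of_odd)
    (W : WeierstrassCurve ℚ) [W.IsElliptic] [W.IsGloballyMinimal] [Fact (Nat.Prime 3)]
    (hGS : W.HasSplitMultiplicativeReductionAtPrime 3 → greenberg_stevens (W := W) (p := 3))
    (hX : ClassX11a W 3) (hns : ¬ Surj W 3) : Typed.MissingUpperBoundAt W 3 :=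
  X11b.missingUpperBoundAt_of_multDivisibilityAt_of_analyticRank_eq_zero_noGZK_of_greenberg hGs hGn hnf W 3 hGS hX.2.1
    hX.2.2.1 hX.1 (X11b.multDivisibilityAt_three_of_not_surj_of_sixFacts h12 hnf hns' hsp' hfine' hMz W hX.2.2.1 hX.2.2.2.1 hns)

end Summit.BirchSwinnertonDyer.Rank1Residual.ClassX11a

namespace Summit.BirchSwinnertonDyer.BirchSwinnertonDyer.Theorems.GreenbergRankZero

/-- **Crux U3 `Theses.PrintX11a.UpperNonSurjThree` (item 20613) BY NAME from nine print-exact named facts, Greenberg-typed**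
(sorry-free, CONDITIONAL; closes nothing by itself): at every X11a pair with `ρ̄_{E,3}` not surjective, `ord₃ #Ш(E) ≤ ord₃ #Ш(E)_an`,
granted Greenberg's rank-`0` formula at a split (`hGs`) ∕ non-split (`hGn`) multiplicative prime (LNM 1716 §4, rows G104 ∕ G103),
Greenberg–Stevens ∕ Kobayashi at ODD primes (`hGS`), Kato 12.4 (`h12`), modularity (`hnf`), Kato §17.13 V′ ∕ VI′ ∕ XI′
(`hns'`, `hsp'`, `hfine'`) and Mazur Cor. 4.1 (`hMz`).  Twin of `Theorems.upperNonSurjThree_of_nineFacts_oddGS` (p625569) with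
`hJs hJn ↦ hGs hGn`; the lead's r7 composition constant for line «finemu3».  BSD is not proved by any of this.
[cite: GreenbergLNM1716, §4, the passage following Thm. 4.1 (pp. 111–113)] [cite: Kobayashi2006DocMath, Cor. 4.2 (p. 575)]
[cite: Kato2004Asterisque, Thm. 12.4 (p. 221) and §17.13 (pp. 279–280)] [cite: Mazur1978, Cor. 4.1] -/
theorem upperNonSurjThree_of_greenberg_of_sevenFacts
    (hGs : Greenberg1999.thm41Analogue_charValue_rankZero_split_baseChange_anyPrime)
    (hGn : Greenberg1999.thm41Analogue_charValue_rankZero_numberField)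
    (hGS : ∀ (W : WeierstrassCurve ℚ) [W.IsElliptic] [W.IsGloballyMinimal] (p : ℕ) [Fact p.Prime],
      p ≠ 2 → greenberg_stevens (W := W) (p := p))
    (h12 : Kato2004.thm12_4) (hnf : exists_isNewformOf)
    (hns' : Kato2004.exists_multDivisibilityInputs_nonsplit_contra)
    (hsp' : Kato2004.exists_multDivisibilityInputs_split_contra)
    (hfine' : Kato2004.exists_multDivisibilityInputs_fine_contra) (hMz : mazur_not_dvd_maninConstant_of_odd) :
    Summit.BirchSwinnertonDyer.BirchSwinnertonDyer.Theses.PrintX11a.UpperNonSurjThree := by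
  intro W _ _ p _ hX hns hp3
  subst hp3
  exact Rank1Residual.ClassX11a.missingUpperBoundAt_three_of_not_surj_of_nineFacts_of_greenberg hGs hGn h12 hnf hns' hsp'
    hfine' hMz W (fun _ => hGS W 3 (by decide)) hX hns

/-- **Glue shape, Greenberg-typed**: the nine-fact conjunction with SW 6.1 ×2 ↦ Greenberg's rank-`0` formula ×2 (GS at odd
primes) implies `UpperNonSurjThree`.  CONDITIONAL; closes nothing.  [cite: GreenbergLNM1716, §4, after Thm. 4.1 (pp. 111–113)] -/
theorem upperNonSurjThree_of_nineFactsGreenberg_glue :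
    (Greenberg1999.thm41Analogue_charValue_rankZero_split_baseChange_anyPrime ∧
      Greenberg1999.thm41Analogue_charValue_rankZero_numberField ∧
      (∀ (W : WeierstrassCurve ℚ) [W.IsElliptic] [W.IsGloballyMinimal] (p : ℕ) [Fact p.Prime],
        p ≠ 2 → greenberg_stevens (W := W) (p := p)) ∧
      Kato2004.thm12_4 ∧ exists_isNewformOf ∧ Kato2004.exists_multDivisibilityInputs_nonsplit_contra ∧
      Kato2004.exists_multDivisibilityInputs_split_contra ∧ Kato2004.exists_multDivisibilityInputs_fine_contra ∧
      mazur_not_dvd_maninConstant_of_odd) →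
    Summit.BirchSwinnertonDyer.BirchSwinnertonDyer.Theses.PrintX11a.UpperNonSurjThree :=
  fun ⟨hGs, hGn, hGS, h12, hnf, hns', hsp', hfine', hMz⟩ ↦
    upperNonSurjThree_of_greenberg_of_sevenFacts hGs hGn hGS h12 hnf hns' hsp' hfine' hMz

end Summit.BirchSwinnertonDyer.BirchSwinnertonDyer.Theorems.GreenbergRankZero

end
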